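import Summits.QuantumFields.YangMills.Theorems.AllWindowsColdBoxBoxHighLineCubicDecorrelationOf
import Summits.QuantumFields.YangMills.Theorems.AllWindowsColdBoxBoxHighLineCubicVarianceOf
import Summits.QuantumFields.YangMills.Theorems.AllWindowsColdBoxBoxHighLineWilsonPlaquetteTaylor

/-!
# T-S5.12a `cubicVariance : CubicVariance` and T-S5.10 `cubicDecorrelation : CubicDecorrelation` BY NAME

The one-liners closing planner ym-idea-2 g18's task Props 12a and 10 of `TaskS5Step2Wick.lean` (✓`…Step2Wick`): ✓`cubicVariance_of_wilsonPlaquetteTaylor` /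
✓`cubicDecorrelation_of_wilsonPlaquetteTaylor` (LEAD g77) applied to w2 g31's ✓`wilsonPlaquetteTaylor : WilsonPlaquetteTaylor` (T-S5.7a).

HONEST LABEL: two support bricks of STEP 2 of the XL stub S5 (`stub_landauSecondOrder`) of the critic-PASSed DRAFT line LINE-19; T-S5.13/S5, U5,
⟨stmt-QuantumFields-24004⟩ ⟨24335⟩ ⟨24336⟩ remain OPEN; route AllWindowsColdBox is DRAFT; no rung is proved; the Yang–Mills mass gap is NOT proved by this file; no summit is
proved by a line.  Seat ym-line-sfw-p2 g77 (LEAD, cell ym-idea-1; Wick layer T-S5.10/11/12a).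
-/

set_option autoImplicit false

namespace Summit.QuantumFields.YangMills.Theorems.AllWindowsColdBoxBoxHighLine

/-- ★★★ **T-S5.12a by name**: `E₀[V₃²] ≤ C·H⁴(1+log H)³/β` for `β ≥ H⁴`, `H ≥ 1` (with `m = 3`). -/
theorem cubicVariance : CubicVariance := cubicVariance_of_wilsonPlaquetteTaylor wilsonPlaquetteTaylor

/-- ★★★ **T-S5.10 by name**: `E₀[c̃₀²·V₃²] ≤ C·(1+log H)⁵·H⁴/β³` for `β ≥ H⁴`, `H ≥ 1` (with `m = 5`). -/
theorem cubicDecorrelation : CubicDecorrelation := cubicDecorrelation_of_wilsonPlaquetteTaylor wilsonPlaquetteTaylor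

end Summit.QuantumFields.YangMills.Theorems.AllWindowsColdBoxBoxHighLine
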